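import Mathlib
import HarnessLib

/-!
# `OrthantWake.DyadicBreakBelowOne` — tools for a Barbato–Morandin-type 2-mode invariant region at
# an ARBITRARY shell ratio: the boundary inequalities, abstract in the certificate

Item stmt-NavierStokesRegularity-24644 (`OrthantWake.DyadicBreakBelowOne`, aside).  In weighted
variables `Yₙ = b^{wn} X_{0,n}` (`b = 1+ε₀`, `w > 1/2`) the one-mode chain of the tree is the
nearest-neighbour system `Ẏₙ = -κₙ Yₙ + Fₙ (Y_{n-1}² - D Yₙ Y_{n+1})` with `κ_{n+1} = V κₙ`
(`V = b²`), `F_{n+1} = K Fₙ` (`K = b^{5/2-w}`), drain `D = b^{5/2-3w}` — the field of Barbato–Morandin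
2013, §5 (base `2`: `D = 2`) and of Barbato–Morandin–Romito 2011, Lemma 2.1 (`D = λ^γ`, `K = λ^{2-ε}`,
`V = λ²`, tree: `Literature.Barriers.NavierStokesRegularity.Dyadic.invariantRegion_le_one`, pinned
to `λ = 2`).  This file isolates, for the CUBIC region
`A = {0 ≤ x ≤ 1, h(x) ≤ y ≤ m x + θ}`, `h(x) = c((x-δ)/(1-δ))³` (`x > δ`), `h(x) = 0` (`x ≤ δ`),
the three "active constraint has a strictly negative derivative" inequalities of the first-exit
argument, with the ratio-dependent numerics left as HYPOTHESES (the certificate):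

* `dyadicRegion_rhs_neg_at_one` — right/top piece (`D c ≥ 1`);
* `dyadicRegion_top_slant_deriv_neg` — slanted piece, given the certificate value
  `K(x² − D y h(y)) + m D x y ≤ 0` at `y = m x + θ`;
* `dyadicRegion_bottom_curve_deriv_neg` — curved piece, given `V(1−δ) ≤ 3` (viscous star-shape of
  the cubic) and the certificate value `h′(x)(1 − D x h(x)) − K(x² − D h(x)(m h(x) + θ)) < 0`;
* `dyadicRegion_bottom_corner_deriv_neg` — the corner `x = δ`;
* `dyadicRegion_hasDerivAt_curve`, `dyadicRegion_continuous_curve` — the cubic is `C¹`.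

Theorem-only module (no definitions: the curve is written out).  MODEL lattice bookkeeping; nothing
here is a statement about the Navier–Stokes equations.
-/

noncomputable section

set_option linter.dupNamespace false

namespace Summit.NavierStokesRegularity.NavierStokesRegularity.Theorems

open Set Filter Topology

/-! ## The cubic lower curve -/

/-- **The cubic lower curve is `C¹`.** `h(y) = c((y-δ)/(1-δ))³` for `y > δ`, `0` for `y ≤ δ`
(`δ < 1`) has derivative `3c((y-δ)/(1-δ))²/(1-δ)` for `y > δ` and `0` for `y ≤ δ` at every point
(the branches match to first order at `δ`). [cite: BarbatoMorandin2012, §5 (the region `A`, cubic `h`)] -/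
theorem dyadicRegion_hasDerivAt_curve {δ : ℝ} (hδ : δ < 1) (c y : ℝ) :
    HasDerivAt (fun x : ℝ => if x ≤ δ then (0 : ℝ) else c * ((x - δ) / (1 - δ)) ^ 3)
      (if y ≤ δ then (0 : ℝ) else 3 * c * ((y - δ) / (1 - δ)) ^ 2 / (1 - δ)) y := by
  have hq : ∀ x : ℝ, HasDerivAt (fun x : ℝ => c * ((x - δ) / (1 - δ)) ^ 3)
      (3 * c * ((x - δ) / (1 - δ)) ^ 2 / (1 - δ)) x := by
    intro x
    have h1 : HasDerivAt (fun x : ℝ => (x - δ) / (1 - δ)) (1 / (1 - δ)) x := by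
      simpa using ((hasDerivAt_id x).sub_const δ).div_const (1 - δ)
    have h2 := (h1.pow 3).const_mul c
    refine h2.congr_deriv ?_
    push_cast
    ring
  rcases lt_trichotomy y δ with hy | hy | hy
  · have hev : (fun x : ℝ => if x ≤ δ then (0 : ℝ) else c * ((x - δ) / (1 - δ)) ^ 3) =ᶠ[𝓝 y]
        fun _ => 0 := by
      filter_upwards [Iio_mem_nhds hy] with x hx
      rw [if_pos (le_of_lt hx)]
    rw [if_pos hy.le]
    exact (hasDerivAt_const y (0 : ℝ)).congr_of_eventuallyEq hev
  · subst hy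
    rw [if_pos le_rfl]
    have hl : HasDerivWithinAt
        (fun x : ℝ => if x ≤ y then (0 : ℝ) else c * ((x - y) / (1 - y)) ^ 3) 0 (Iic y) y :=
      (hasDerivWithinAt_const _ _ (0 : ℝ)).congr (fun x (hx : x ≤ y) => by rw [if_pos hx])
        (by rw [if_pos le_rfl])
    have hr : HasDerivWithinAt
        (fun x : ℝ => if x ≤ y then (0 : ℝ) else c * ((x - y) / (1 - y)) ^ 3) 0 (Ici y) y := by
      have h0 : 3 * c * ((y - y) / (1 - y)) ^ 2 / (1 - y) = 0 := by simp
      have := (hq y).hasDerivWithinAt (s := Ici y)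
      rw [h0] at this
      refine this.congr (fun x (hx : y ≤ x) => ?_) (by simp)
      rcases eq_or_lt_of_le hx with rfl | hlt
      · simp
      · rw [if_neg (not_le.2 hlt)]
    have := hl.union hr
    rwa [Iic_union_Ici, hasDerivWithinAt_univ] at this
  · have hev : (fun x : ℝ => if x ≤ δ then (0 : ℝ) else c * ((x - δ) / (1 - δ)) ^ 3) =ᶠ[𝓝 y]
        fun x => c * ((x - δ) / (1 - δ)) ^ 3 := by
      filter_upwards [Ioi_mem_nhds hy] with x hx
      rw [if_neg (not_le.2 hx)]
    rw [if_neg (not_le.2 hy)]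
    exact (hq y).congr_of_eventuallyEq hev

/-- The cubic lower curve is continuous. [cite: BarbatoMorandin2012, §5] -/
theorem dyadicRegion_continuous_curve {δ : ℝ} (hδ : δ < 1) (c : ℝ) :
    Continuous (fun x : ℝ => if x ≤ δ then (0 : ℝ) else c * ((x - δ) / (1 - δ)) ^ 3) :=
  continuous_iff_continuousAt.2 fun y => (dyadicRegion_hasDerivAt_curve hδ c y).continuousAt

/-! ## Inward pointing on the pieces of the boundary (abstract in the certificate) -/

/-- **Right piece `x = 1` / top piece `y = 1`**: a mode sitting at `1`, with the mode below in
`[0, 1]` and the mode above at least `c`, has right-hand side `≤ -κ < 0` because `D c ≥ 1`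
(corner condition). [cite: BarbatoMorandinRomito2011, §2 Lemma 2.1 (pieces n₃, n₄)] -/
theorem dyadicRegion_rhs_neg_at_one {κ F D c w z : ℝ} (hκ : 0 < κ) (hF : 0 ≤ F) (hD : 0 ≤ D)
    (hDc : 1 ≤ D * c) (hw0 : 0 ≤ w) (hw1 : w ≤ 1) (hz : c ≤ z) :
    -κ * 1 + F * (w ^ 2 - D * 1 * z) < 0 := by
  have h1 : w ^ 2 ≤ 1 := by nlinarith
  have h2 : 1 ≤ D * z := hDc.trans (mul_le_mul_of_nonneg_left hz hD)
  nlinarith [mul_nonneg hF (by linarith : 0 ≤ D * 1 * z - w ^ 2)]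

/-- **Slanted top piece `y = m x + θ`**: the derivative of `Y_{n+1} - m Yₙ - θ` is strictly
negative there.  Viscous part `-κ_{n+1} y + m κₙ x ≤ -κₙ θ < 0`; inviscid part `≤ 0` by
`z ≥ h(y)` and the CERTIFICATE value `K(x² − D y h(y)) + m D x y ≤ 0` (hypothesis `hψ`).
[cite: BarbatoMorandinRomito2011, §2 Lemma 2.1 (piece n₂, (2.2))] -/
theorem dyadicRegion_top_slant_deriv_neg {κn κn1 Fn K D m θ x y z w hy_val : ℝ}
    (hκn : 0 < κn) (hκmono : κn ≤ κn1) (hFn : 0 < Fn) (hK : 0 ≤ K) (hD : 0 ≤ D) (hm : 0 ≤ m)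
    (hθ : 0 < θ) (hx : 0 ≤ x) (hy : y = m * x + θ) (hz : hy_val ≤ z)
    (hψ : K * (x ^ 2 - D * y * hy_val) + m * D * x * y ≤ 0) :
    (-κn1 * y + K * Fn * (x ^ 2 - D * y * z)) - m * (-κn * x + Fn * (w ^ 2 - D * x * y)) < 0 := by
  have hy0 : 0 < y := by rw [hy]; positivity
  -- viscous part
  have hv : -κn1 * y + m * (κn * x) < 0 := by
    have h1 : κn * y ≤ κn1 * y := mul_le_mul_of_nonneg_right hκmono hy0.le
    have h2 : -κn * y + m * (κn * x) = -(κn * θ) := by rw [hy]; ring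
    nlinarith [mul_pos hκn hθ]
  -- inviscid part
  have hi : K * (x ^ 2 - D * y * z) + m * (D * x * y) ≤ 0 := by
    have h1 : K * (x ^ 2 - D * y * z) ≤ K * (x ^ 2 - D * y * hy_val) := by
      apply mul_le_mul_of_nonneg_left _ hK
      nlinarith [mul_le_mul_of_nonneg_left hz (mul_nonneg hD hy0.le)]
    nlinarith
  have hw : 0 ≤ Fn * (m * w ^ 2) := mul_nonneg hFn.le (mul_nonneg hm (sq_nonneg w))
  have key : (-κn1 * y + K * Fn * (x ^ 2 - D * y * z)) - m * (-κn * x + Fn * (w ^ 2 - D * x * y)) =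
      (-κn1 * y + m * (κn * x)) + Fn * (K * (x ^ 2 - D * y * z) + m * (D * x * y)) -
        Fn * (m * w ^ 2) := by ring
  rw [key]
  nlinarith [mul_nonpos_of_nonneg_of_nonpos hFn.le hi]

/-- **Curved bottom piece `y = h(x)`, `x ≥ δ`** (cubic `h`): the derivative of `h(Yₙ) - Y_{n+1}`
is strictly negative there.  Viscous part `≤ 0` since `x h′(x) ≥ V h(x)` on `[δ,1]` as soon as
`V(1−δ) ≤ 3` and `κ_{n+1} ≤ V κₙ`; inviscid part `< 0` by `z ≤ m y + θ`, `w² ≤ 1` and the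
CERTIFICATE value `h′(x)(1 − D x h(x)) − K(x² − D h(x)(m h(x)+θ)) < 0` (hypothesis `hψ`).
[cite: BarbatoMorandinRomito2011, §2 Lemma 2.1 (piece n₅, (2.3))] -/
theorem dyadicRegion_bottom_curve_deriv_neg {κn κn1 Fn K D V m θ c δ x y z w : ℝ}
    (hκn : 0 ≤ κn) (hκV : κn1 ≤ V * κn) (hVδ : V * (1 - δ) ≤ 3) (hFn : 0 < Fn) (hK : 0 ≤ K)
    (hD : 0 ≤ D) (hc : 0 ≤ c) (hδ0 : 0 ≤ δ) (hδ1 : δ < 1) (hx0 : δ ≤ x) (hx1 : x ≤ 1)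
    (hy : y = c * ((x - δ) / (1 - δ)) ^ 3) (hz : z ≤ m * y + θ) (hw0 : 0 ≤ w) (hw1 : w ≤ 1)
    (hψ : 3 * c * ((x - δ) / (1 - δ)) ^ 2 / (1 - δ) * (1 - D * x * y) -
      K * (x ^ 2 - D * y * (m * y + θ)) < 0) :
    3 * c * ((x - δ) / (1 - δ)) ^ 2 / (1 - δ) * (-κn * x + Fn * (w ^ 2 - D * x * y)) -
      (-κn1 * y + K * Fn * (x ^ 2 - D * y * z)) < 0 := by
  have h1δ : 0 < 1 - δ := by linarith
  set u : ℝ := (x - δ) / (1 - δ) with hu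
  have hu0 : 0 ≤ u := by rw [hu]; exact div_nonneg (by linarith) h1δ.le
  have hxu : x - δ = (1 - δ) * u := by rw [hu]; field_simp
  have hy0 : 0 ≤ y := by rw [hy]; positivity
  have hhp : 0 ≤ 3 * c * u ^ 2 / (1 - δ) := by positivity
  -- viscous part: `h'(x) κₙ x ≥ V κₙ h(x) ≥ κ_{n+1} h(x)`
  have hv : 0 ≤ 3 * c * u ^ 2 / (1 - δ) * (κn * x) - κn1 * y := by
    have hlin : V * (x - δ) ≤ 3 * x := by
      rcases le_or_gt V 3 with hV3 | hV3
      · nlinarith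
      · nlinarith
    have h2 : κn1 * y ≤ V * κn * y := mul_le_mul_of_nonneg_right hκV hy0
    have h3 : V * κn * y ≤ 3 * c * u ^ 2 / (1 - δ) * (κn * x) := by
      rw [hy]
      have e1 : V * κn * (c * u ^ 3) = κn * (c * u ^ 2) * (V * u) := by ring
      have e2 : 3 * c * u ^ 2 / (1 - δ) * (κn * x) = κn * (c * u ^ 2) * (3 * x / (1 - δ)) := by
        ring
      rw [e1, e2]
      apply mul_le_mul_of_nonneg_left _ (by positivity)
      rw [le_div_iff₀ h1δ]
      calc V * u * (1 - δ) = V * (x - δ) := by rw [hxu]; ring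
        _ ≤ 3 * x := hlin
    linarith
  -- inviscid part: replace `w` and `z` by their bounds
  have hB1 : w ^ 2 - D * x * y ≤ 1 - D * x * y := by nlinarith
  have hB2 : -(K * (x ^ 2 - D * y * z)) ≤ -(K * (x ^ 2 - D * y * (m * y + θ))) := by
    have : K * (D * y * z) ≤ K * (D * y * (m * y + θ)) :=
      mul_le_mul_of_nonneg_left (mul_le_mul_of_nonneg_left hz (mul_nonneg hD hy0)) hK
    nlinarith
  have hi : 3 * c * u ^ 2 / (1 - δ) * (w ^ 2 - D * x * y) - K * (x ^ 2 - D * y * z) < 0 := by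
    have e1 := mul_le_mul_of_nonneg_left hB1 hhp
    linarith
  have key : 3 * c * u ^ 2 / (1 - δ) * (-κn * x + Fn * (w ^ 2 - D * x * y)) -
      (-κn1 * y + K * Fn * (x ^ 2 - D * y * z)) =
      -(3 * c * u ^ 2 / (1 - δ) * (κn * x) - κn1 * y) +
        Fn * (3 * c * u ^ 2 / (1 - δ) * (w ^ 2 - D * x * y) - K * (x ^ 2 - D * y * z)) := by ring
  rw [key]
  nlinarith [mul_pos hFn (neg_pos.2 hi)]

/-- **Corner of the bottom piece, `x = δ`**: there `h = h′ = 0` and `Y_{n+1} = 0`, so the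
derivative of `h(Yₙ) - Y_{n+1}` is `-F_{n+1} δ² < 0` (`δ ≠ 0`).
[cite: BarbatoMorandinRomito2011, §2 Lemma 2.1 (piece n₅)] -/
theorem dyadicRegion_bottom_corner_deriv_neg {κn1 Fn1 D δ z A : ℝ} (hF : 0 < Fn1) (hδ : δ ≠ 0) :
    0 * A - (-κn1 * 0 + Fn1 * (δ ^ 2 - D * 0 * z)) < 0 := by
  have : 0 < δ ^ 2 := by positivity
  nlinarith [mul_pos hF this]

/-! ## Elementary facts about the region on `[0,1]` -/

/-- On the curve, above `δ`: `h(x) = c u³ ≤ c ≤ 1` for `x ≤ 1` (`u ≤ 1`). [folklore] -/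
theorem dyadicRegion_curve_le {c δ x : ℝ} (hc0 : 0 ≤ c) (hc1 : c ≤ 1) (hδ1 : δ < 1)
    (hx0 : δ ≤ x) (hx1 : x ≤ 1) : c * ((x - δ) / (1 - δ)) ^ 3 ≤ 1 := by
  have h1δ : 0 < 1 - δ := by linarith
  have hu0 : 0 ≤ (x - δ) / (1 - δ) := div_nonneg (by linarith) h1δ.le
  have hu1 : (x - δ) / (1 - δ) ≤ 1 := by rw [div_le_one h1δ]; linarith
  have : ((x - δ) / (1 - δ)) ^ 3 ≤ 1 := pow_le_one₀ hu0 hu1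
  nlinarith

/-- At `x = 1` the curve has height `c`. [folklore] -/
theorem dyadicRegion_curve_one {c δ : ℝ} (hδ1 : δ < 1) : c * ((1 - δ) / (1 - δ)) ^ 3 = c := by
  rw [div_self (by linarith : (1 : ℝ) - δ ≠ 0)]; ring

end Summit.NavierStokesRegularity.NavierStokesRegularity.Theorems

end
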